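import Mathlib.Computability.MyhillNerode
import Mathlib.Computability.Language
import Mathlib.Data.Set.Finite.List
import Mathlib.Logic.Equiv.Fin.Basic
import Mathlib.Data.List.OfFn
import Mathlib.Tactic.Ring

/-!
# Block-tensor transfer, part I: Kleene stars of uniform-length languages ("block codes")

Support item `BlockTensorTransfer` (stmt-MatrixMultiplication-7361) of route
MatrixMultiplication/AutomaticSTPPDesigns, helper file 1/3 (pure automata theory, no arithmetic).

For a language `W` over an alphabet `α` all of whose words have the same length `K ≥ 1` (the *block
words*), the Kleene star `W∗` — all concatenations of block words — is read block by block: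

* `append_mem_kstar_iff` — across a block boundary (`K ∣ |x|`) membership of `x ++ y` splits into
  membership of `x` and of `y`;
* `length_dvd_of_mem_kstar` — every word of `W∗` has length divisible by `K`;
* `ofFn_mem_kstar_iff` — a word of length `m * K` lies in `W∗` iff each of its `m` consecutive blocks
  (positions `finProdFinEquiv (t, j) = j + K t`, `j < K`) lies in `W`;
* `isRegular_kstar_of_length_eq` — over a finite alphabet `W∗` is REGULAR, by Myhill–Nerode
  (`Language.isRegular_iff_finite_range_leftQuotient`): its left quotients are `0` and the quotients
  by the finitely many words of length `< K`.

These are folklore; they are kept here (riding with the item as `--supports`) because Mathlib has no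
closure of `Language.IsRegular` under Kleene star at the pinned revision.
-/

-- the tree's namespace `Summit.MatrixMultiplication.MatrixMultiplication.…` repeats a component by design
set_option linter.dupNamespace false

namespace Summit.MatrixMultiplication.MatrixMultiplication.Theorems.BlockTensorTransfer

open scoped Computability
open Language List

variable {α : Type*} {W : Language α} {K : ℕ}

/-- A concatenation of words of length `K` has length `(number of words) * K`. -/
theorem length_flatten_of_forall_length_eq {S : List (List α)} (hS : ∀ z ∈ S, z.length = K) :
    S.flatten.length = S.length * K := by
  induction S with
  | nil => simp
  | cons z S ih =>
    rw [List.flatten_cons, List.length_append, hS z (by simp),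
      ih (fun y hy => hS y (by simp [hy])), List.length_cons]
    ring

/-- Every word of `W∗` has length divisible by the common block length `K`. -/
theorem length_dvd_of_mem_kstar (hW : ∀ z ∈ W, z.length = K) {x : List α} (hx : x ∈ W∗) :
    K ∣ x.length := by
  obtain ⟨S, rfl, hS⟩ := Language.mem_kstar.1 hx
  exact ⟨S.length, by rw [length_flatten_of_forall_length_eq (fun z hz => hW z (hS z hz)), mul_comm]⟩

/-- Concatenation of uniform-length words is injective: two lists of words of length `K ≥ 1` with the
same concatenation are equal. -/
theorem flatten_injective_of_length_eq (hK : 0 < K) :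
    ∀ {S T : List (List α)}, (∀ z ∈ S, z.length = K) → (∀ z ∈ T, z.length = K) →
      S.flatten = T.flatten → S = T := by
  intro S
  induction S with
  | nil =>
    intro T _ hT h
    cases T with
    | nil => rfl
    | cons t T =>
      exfalso
      have hlen := congrArg List.length h
      rw [List.flatten_nil, List.flatten_cons, List.length_append, hT t (by simp)] at hlen
      simp only [List.length_nil] at hlen
      omega
  | cons s S ih =>
    intro T hS hT h
    cases T with
    | nil =>
      exfalso
      have hlen := congrArg List.length h
      rw [List.flatten_nil, List.flatten_cons, List.length_append, hS s (by simp)] at hlen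
      simp only [List.length_nil] at hlen
      omega
    | cons t T =>
      rw [List.flatten_cons, List.flatten_cons] at h
      have hst : s.length = t.length := by rw [hS s (by simp), hT t (by simp)]
      obtain ⟨h1, h2⟩ := List.append_inj h hst
      rw [h1, ih (fun z hz => hS z (by simp [hz])) (fun z hz => hT z (by simp [hz])) h2]

/-- **Block boundaries.** If `K ∣ |x|` then `x ++ y ∈ W∗ ↔ x ∈ W∗ ∧ y ∈ W∗` (all words of `W` having
length `K ≥ 1`). -/
theorem append_mem_kstar_iff (hK : 0 < K) (hW : ∀ z ∈ W, z.length = K) {x y : List α}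
    (hx : K ∣ x.length) : x ++ y ∈ W∗ ↔ x ∈ W∗ ∧ y ∈ W∗ := by
  constructor
  · intro h
    obtain ⟨S, hS, hSW⟩ := Language.mem_kstar.1 h
    obtain ⟨a, ha⟩ := hx
    have hSl : ∀ z ∈ S, z.length = K := fun z hz => hW z (hSW z hz)
    -- `S` has at least `a` blocks
    have haS : a ≤ S.length := by
      have hlen := congrArg List.length hS
      rw [List.length_append, length_flatten_of_forall_length_eq hSl, ha] at hlen
      by_contra hlt
      rw [not_le] at hlt
      have h' : S.length * K + K ≤ a * K := by
        have := Nat.mul_le_mul_right K hlt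
        rwa [Nat.succ_mul] at this
      rw [mul_comm K a] at hlen
      omega
    have h1 : (S.take a).flatten.length = x.length := by
      rw [length_flatten_of_forall_length_eq (fun z hz => hSl z (List.mem_of_mem_take hz)),
        List.length_take, min_eq_left haS, ha, mul_comm]
    have hsplit : x ++ y = (S.take a).flatten ++ (S.drop a).flatten := by
      rw [← List.flatten_append, List.take_append_drop]; exact hS
    obtain ⟨hx', hy'⟩ := List.append_inj hsplit h1.symm
    refine ⟨?_, ?_⟩
    · rw [hx']; exact Language.join_mem_kstar fun z hz => hSW z (List.mem_of_mem_take hz)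
    · rw [hy']; exact Language.join_mem_kstar fun z hz => hSW z (List.mem_of_mem_drop hz)
  · rintro ⟨h1, h2⟩
    obtain ⟨S, rfl, hS⟩ := Language.mem_kstar.1 h1
    obtain ⟨T, rfl, hT⟩ := Language.mem_kstar.1 h2
    rw [← List.flatten_append]
    exact Language.join_mem_kstar fun z hz => by
      rcases List.mem_append.1 hz with hz | hz
      exacts [hS z hz, hT z hz]

/-- **Reading a word of length `m * K` block by block.** For `f : Fin (m * K) → α`, the word
`List.ofFn f` lies in `W∗` iff each of its `m` blocks `j ↦ f (finProdFinEquiv (t, j))` (positions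
`j + K t`, `j < K`) lies in `W` (all words of `W` having length `K ≥ 1`). -/
theorem ofFn_mem_kstar_iff (hK : 0 < K) (hW : ∀ z ∈ W, z.length = K) {m : ℕ}
    (f : Fin (m * K) → α) :
    List.ofFn f ∈ W∗ ↔ ∀ t : Fin m, List.ofFn (fun j : Fin K => f (finProdFinEquiv (t, j))) ∈ W := by
  -- the block decomposition of `ofFn f`
  set T : List (List α) := List.ofFn fun t : Fin m => List.ofFn fun j : Fin K =>
    f (finProdFinEquiv (t, j)) with hT
  have hfT : List.ofFn f = T.flatten := by
    rw [hT, List.ofFn_mul]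
    congr 1
    rw [List.ofFn_inj]
    funext t
    rw [List.ofFn_inj]
    funext j
    congr 1
    ext
    simp [finProdFinEquiv, Nat.mul_comm, Nat.add_comm]
  have hTl : ∀ z ∈ T, z.length = K := by
    intro z hz
    rw [hT, List.mem_ofFn'] at hz
    obtain ⟨t, rfl⟩ := hz
    exact List.length_ofFn
  constructor
  · intro h t
    obtain ⟨S, hS, hSW⟩ := Language.mem_kstar.1 h
    have hST : S = T :=
      flatten_injective_of_length_eq hK (fun z hz => hW z (hSW z hz)) hTl (hS.symm.trans hfT)
    subst hST
    exact hSW _ (by rw [hT, List.mem_ofFn']; exact ⟨t, rfl⟩)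
  · intro h
    rw [hfT]
    refine Language.join_mem_kstar fun z hz => ?_
    rw [hT, List.mem_ofFn'] at hz
    obtain ⟨t, rfl⟩ := hz
    exact h t

/-- The left quotient of `W∗` by a word `x` ending on a block boundary (`K ∣ |x|`) is `W∗` itself
(if `x ∈ W∗`) or `0` (otherwise). -/
theorem leftQuotient_kstar_of_dvd (hK : 0 < K) (hW : ∀ z ∈ W, z.length = K) {x : List α}
    (hx : K ∣ x.length) :
    (W∗).leftQuotient x = W∗ ∨ (W∗).leftQuotient x = 0 := by
  by_cases h : x ∈ W∗
  · refine Or.inl ?_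
    ext y
    rw [Language.mem_leftQuotient, append_mem_kstar_iff hK hW hx]
    simp [h]
  · refine Or.inr ?_
    ext y
    rw [Language.mem_leftQuotient, append_mem_kstar_iff hK hW hx]
    simp only [h, false_and, false_iff]
    exact Language.notMem_zero y

/-- **`W∗` is regular** for a language `W` of words of one fixed length `K ≥ 1` over a finite
alphabet (Myhill–Nerode: every left quotient of `W∗` is `0` or the quotient by a word of length
`< K`, of which there are finitely many). -/
theorem isRegular_kstar_of_length_eq [Finite α] (hK : 0 < K) (hW : ∀ z ∈ W, z.length = K) :
    (W∗).IsRegular := by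
  apply Language.IsRegular.of_finite_range_leftQuotient
  have hfin : Set.Finite (insert (0 : Language α)
      ((fun u : List α => (W∗).leftQuotient u) '' {u : List α | u.length < K})) :=
    ((List.finite_length_lt α K).image _).insert 0
  refine hfin.subset ?_
  rintro _ ⟨x, rfl⟩
  -- split `x` at its last block boundary
  set a : ℕ := x.length / K with ha
  have hx : x = x.take (a * K) ++ x.drop (a * K) := (List.take_append_drop _ _).symm
  have haK : a * K ≤ x.length := by rw [ha]; exact Nat.div_mul_le_self _ _
  have h1 : K ∣ (x.take (a * K)).length := ⟨a, by rw [List.length_take, min_eq_left haK, mul_comm]⟩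
  have h2 : (x.drop (a * K)).length < K := by
    rw [List.length_drop, ha]
    have := Nat.div_add_mod x.length K
    have hmod := Nat.mod_lt x.length hK
    rw [mul_comm] at this
    omega
  rw [hx, Language.leftQuotient_append]
  rcases leftQuotient_kstar_of_dvd hK hW h1 with hq | hq
  · rw [hq]
    exact Set.mem_insert_of_mem _ ⟨_, h2, rfl⟩
  · rw [hq]
    refine Set.mem_insert_iff.2 (Or.inl ?_)
    ext y
    simp only [Language.mem_leftQuotient]
    exact ⟨fun h => (Language.notMem_zero _ h).elim, fun h => (Language.notMem_zero _ h).elim⟩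

end Summit.MatrixMultiplication.MatrixMultiplication.Theorems.BlockTensorTransfer
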